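import Summits.SmoothPoincare4.SmoothPoincare4.Theses.WeakReductionDescent
import Literature.Topology.FourManifolds.SphereTrisectionsSectors
import Literature.Topology.FourManifolds.TrisectionFunctorGKNaturality
import Literature.Topology.FourManifolds.HomotopyS4CompactProofs
import Literature.Topology.FourManifolds.HomotopyS4OrientableProofs
import Literature.Barriers.SmoothPoincare4.LowGenusTrisectionsStandardProofs

/-!
# Birth attack on crux `WeakReductionDescent.DependentTripleAtThree` (X₁, rung g = 3 as a dependent triple) — findings: SPC4-shielded (`S → C` proved), a kill = an exotic S⁴ of trisection genus 3 with no dependent triple, `C ↔ NoMinimalGenus 3` modulo the sibling support X_F (restates the (3;1,1,1) frontier, as the planner declares), trisection hypothesis load-bearing, faithful to AZ25 §1/§7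

Seat refuter-rattack-stmt-SmoothPoincare4-17999-0, 2026-08-17.  Route
`route-SmoothPoincare4-WeakReductionDescent` rev 2, crux rank 4, item stmt-SmoothPoincare4-17999,
opened by planner-cstrat-stmt-SmoothPoincare4-17907-s1-0 as piece X₁ of the rung split of K1
(`Cruxes/MinimalWeaklyReducible/Lines/rung_split.lean`, stub `stub_dependentTripleAtThree`).
The shield lemmas of §(a) re-derive, for self-containedness (crux workfiles are not built on the
farm, so `Cruxes/MinimalWeaklyReducible/BirthAttack.lean` cannot be imported), the argument of
refuter-rattack-stmt-SmoothPoincare4-17907-0 / -17834-0; credit there.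

Kernel-checked content (this file is sorry-free):

* (c) `dependentTripleAtThree_iff` — the `let`-bound dependent-triple clause factored as
  `DT M T` (`Iff.rfl`): the clause mentions neither `k` nor `e`.
* (a) `dependentTripleAtThree_of_spc4 : SmoothPoincare4 → DependentTripleAtThree` — the
  restates-summit probe `S → C` HOLDS, by VACUITY of `IsGKTrisection M 3 k T ∧ minimal`: the
  round `S⁴` carries GK's genus-`0` trisection (`sphere_genusZero_gkTrisection_holds`, PROVED in
  tree), transported along the diffeomorphism SPC4 provides (`IsGKTrisection.image_diffeomorph'`,
  PROVED), so no genus `≥ 1` is minimal for an `M ≅ S⁴`.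
* (b) `not_spc4_of_not_dependentTripleAtThree`, `exotic_of_not_dependentTripleAtThree` — KILL
  CRITERION: a refutation is an exotic 4-sphere, namely a smooth homotopy 4-sphere of (minimal)
  trisection genus exactly 3 whose minimal trisection admits no dependent triple, with no
  diffeomorphism to `S⁴`.  No refutation short of `¬ SmoothPoincare4`.
* (d) `dependentTripleAtThree_iff_noMinimalGenus_three` — modulo the route's own support
  `DependentTripleGenusThreeStandard` (X_F = Aranda–Zupan 2025 Thm 1.4 / Cor 1.5 for homotopy
  spheres) the crux is EQUIVALENT to "no smooth homotopy 4-sphere has a minimal GK-trisection of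
  genus 3" (`NoMinimalGenus 3`, the first open type (3;1,1,1) of `LowGenusTrisectionBarrier`);
  `dependentTripleGenusThreeStandard_of_spc4` — X_F is itself SPC4-implied; and
  `dependentTripleAtThree_of_K1_of_genusThreeBase` — the crux follows from K1 + `GenusThreeBase`
  (the informal "implied by K1 at genus 3" needs a push-off of `c′`, not formalised; modulo
  AZ25 Thm 1.3 it is immediate).  The probe `C → S` is NOT available (the crux is silent above
  genus 3 and, without X_F, on what a dependent triple yields).
* (f) NOT DECORATION: `dt_false_without_trisection` — dropping `IsGKTrisection M 3 k T` (and
  minimality with it), keeping the bare binders and `e`, the statement is FALSE: `M = S⁴`,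
  `T = fun _ ↦ ∅` has empty central surface while a curve is the range of a map from the nonempty
  circle.  Any proof must use the trisection hypothesis.
* (g) THE TYPE.  `sum_k_eq_three` — under the crux's hypotheses `k 0 + k 1 + k 2 = 3`
  UNCONDITIONALLY (the proved Euler-characteristic fact
  `gkTrisection_genus_eq_sum_of_homotopyEquiv_sphere_holds`, with compactness / connectedness /
  orientation of `M` assembled from `e` as in `Theorems/WeakReductionDescentTrisectionsExist`);
  `k_eq_one_of_minimal_of_msz` — MODULO the tree's unproved named fact
  `Literature.Barriers.SmoothPoincare4.msz_homotopySphere_gk` (MSZ16 Thm 1.2, large-`k`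
  homotopy-sphere corollary) a MINIMAL genus-3 trisection of a homotopy sphere has type
  `(3;1,1,1)` (minimality ⇒ `IsEmpty (M ≃ₘ S⁴)` ⇒ `eq_one_of_exotic_of_genus_three_of_msz_alone`);
  hence `dependentTripleAtThree_iff_balanced_of_msz : C ↔ C|_(k = 1,1,1)` modulo MSZ.  FINDING
  for the planner: the decl quantifies over ALL `k`; the informal "(hence of type (3;1,1,1))"
  silently uses MSZ16's large-`k` theorem, which is NOT among the route's items (`LowGenusBase`
  covers only `g ≤ 2`): either restrict `k` to `fun _ => 1` and add a support
  "LargeKBase := msz_homotopySphere_gk over the bare binders", or record the needs-fact on X₁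
  (and on K1, whose `g = 3` rung has the same hidden input).  Not a misstatement: with MSZ16 in
  print the decl is true iff its `(3;1,1,1)` case is.

Paper findings (not formalisable here, recorded for the prover / planner):

* FAITHFULNESS.  arXiv:2503.04607 p. 2 L27–29 and §7 p. 24 L62–64: "a dependent triple for T
  consists of three pairwise disjoint non-separating curves α₁, β₁, γ₁ bounding disks in H_α, H_β,
  H_γ, respectively, such that [α₁], [β₁], [γ₁] are linearly dependent in H₁(Σ)".  The decl
  replaces linear dependence by `¬ IsPreconnected (F ∖ (a ∪ b ∪ c))`; for pairwise disjoint simple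
  closed curves on a closed orientable surface these agree (exact sequence
  `H₁(Σ) → H₁(Σ, Σ∖C) ≅ ℤⁿ → H̃₀(Σ∖C) → 0`, the first map being `x ↦ (x·cᵢ)ᵢ`, of rank
  `dim span{[cᵢ]}` by non-degeneracy of the intersection form).  Case (1) of §7 (two curves
  homotopic, i.e. parallel) is allowed on both sides.  One curve per handlebody, `H 0, H 1, H 2`
  = `H_α, H_β, H_γ` up to the labelling the crux quantifies over.  `BoundsDisc`, `IsCurve`,
  `NonSep` are verbatim `Literature.Topology.FourManifolds.Trisection.BoundsDisc/IsCurve/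
  IsNonSeparating` (`WeaklyReducibleTrisections.lean`, `Iff.rfl`-inlined shape).  No junk
  operators; quantifier order = informal text; `k` unrestricted (types other than (3;1,1,1) are
  emptied only via MSZ16/χ, i.e. `LowGenusBase`-grade facts — the prover must carry that).
* MUTATION.  Drop `e : M ≃ₕ S⁴`: FALSE in kind — `#³ℂP²` with its minimal (3;0,0,0)
  trisection (three copies of the genus-1 diagram of `ℂP²`, slopes 0, ∞, 1): the Lagrangians are
  `L_α = ⟨e₁,e₃,e₅⟩`, `L_β = ⟨e₂,e₄,e₆⟩`, `L_γ = ⟨e₁+e₂, e₃+e₄, e₅+e₆⟩`; pairwise disjoint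
  `a ∈ L_α, b ∈ L_β, c ∈ L_γ` have `a·c = Σ aᵢcᵢ = 0`, and `λa + μb + νc = 0` with `ν ≠ 0` forces
  `cᵢ ∝ aᵢ`, hence `Σ aᵢ² = 0`, `a = 0` — no dependent triple exists (2-line linear algebra;
  `ν = 0` is excluded by `L_α ∩ L_β = 0`).  In general for a `(3;0,0,0)`-trisection `L_γ` is the
  graph of `φ : L_α ≅ L_β`, `(x, y) ↦ x·φ(y)` is the intersection form of `X` up to sign
  (Feller–Klug–Schirmer–Zemke 2018), and a
  dependent triple needs an isotropic vector: DEFINITE forms (`#³ℂP²`) have none.  So the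
  homotopy-sphere hypothesis is load-bearing in kind, and the mutated class is inhabited.
  Drop minimality: OPEN (contains "every (3;1,1,1)-trisection of S⁴ admits a dependent triple",
  cf. AZ25 Question 8.3, p. 27).  Replace `3` by `g`: the all-genus version is implied by K1
  (push-off) and is equally shielded; at `g = 0` it fails at the round `S⁴` (`F = S²`, every
  circle separates — Jordan–Schoenflies, paper witness).
* TRIVIALITY probes (`T.lean` in the seat folder): `exact?`/`simp`/`aesop` fail on the crux, on
  its conclusion alone, and on `DependentTripleAtThree → SmoothPoincare4`.
-/

open scoped Manifold ContDiff Topology ContinuousMap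
open Set

namespace Summit.SmoothPoincare4.SmoothPoincare4.Cruxes.DependentTripleAtThree.BirthAttack

set_option linter.dupNamespace false

open Literature.Topology.FourManifolds
open Summit.SmoothPoincare4.SmoothPoincare4.Theses.WeakReductionDescent

/-- The round `4`-sphere of Mathlib. -/
local notation "𝕊⁴" => (Metric.sphere (0 : EuclideanSpace ℝ (Fin 5)) 1)

/-! ### (c) The dependent-triple clause, factored -/

/-- The `let`-bound conclusion of the crux, verbatim, as a predicate of the ambient manifold `M`
and the sectors `T` (it mentions neither `k` nor `e`). [folklore] -/
def DT (M : Type) [TopologicalSpace M] [ChartedSpace (EuclideanSpace ℝ (Fin 4)) M]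
    (T : Fin 3 → Set M) : Prop :=
  (let F : Set M := ⋂ l, T l; let H : Fin 3 → Set M := fun p => ⋂ (l : Fin 3) (_ : l ≠ p), T l; let IsCurve : Set M → Prop := fun c => c ⊆ F ∧ ∃ γ : (Metric.sphere (0 : EuclideanSpace ℝ (Fin 2)) 1) → M, Manifold.IsSmoothEmbedding (𝓡 1) (𝓡 4) ((⊤ : ℕ∞) : WithTop ℕ∞) γ ∧ Set.range γ = c; let BoundsDisc : Set M → Set M → Prop := fun A c => ∃ d : (Metric.closedBall (0 : EuclideanSpace ℝ (Fin 2)) 1) → M, Manifold.IsSmoothEmbedding (𝓡∂ 2) (𝓡 4) ((⊤ : ℕ∞) : WithTop ℕ∞) d ∧ Set.range d ⊆ A ∧ d '' ((𝓡∂ 2).boundary (Metric.closedBall (0 : EuclideanSpace ℝ (Fin 2)) 1)) = c ∧ Set.range d ∩ F = c; let NonSep : Set M → Prop := fun c => IsConnected (F \ c); let DependentTriple : Prop := ∃ (a b c : Set M), IsCurve a ∧ IsCurve b ∧ IsCurve c ∧ Disjoint a b ∧ Disjoint b c ∧ Disjoint a c ∧ NonSep a ∧ NonSep b ∧ NonSep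 c ∧ BoundsDisc (H 0) a ∧ BoundsDisc (H 1) b ∧ BoundsDisc (H 2) c ∧ ¬ IsPreconnected (F \ (a ∪ b ∪ c)); DependentTriple)

/-- "`T` is of minimal genus `g` among the GK-trisections of `M`" — the crux's minimality
hypothesis, factored (for the crux, `g = 3`). [folklore] -/
def IsMinimalGenus (M : Type) [TopologicalSpace M] [ChartedSpace (EuclideanSpace ℝ (Fin 4)) M]
    (g : ℕ) : Prop :=
  ∀ (g' : ℕ) (k' : Fin 3 → ℕ) (T' : Fin 3 → Set M), IsGKTrisection M g' k' T' → g ≤ g'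

/-- The crux, read back through the factorisation — `Iff.rfl`, so `DT` / `IsMinimalGenus` ARE
the decl's clauses. [folklore] -/
theorem dependentTripleAtThree_iff :
    DependentTripleAtThree ↔
      ∀ (M : Type) [TopologicalSpace M] [T2Space M] [SecondCountableTopology M]
        [ChartedSpace (EuclideanSpace ℝ (Fin 4)) M] [IsManifold (𝓡 4) ∞ M],
        (M ≃ₕ 𝕊⁴) → ∀ (k : Fin 3 → ℕ) (T : Fin 3 → Set M),
          IsGKTrisection M 3 k T → IsMinimalGenus M 3 → DT M T :=
  Iff.rfl

/-- "No smooth homotopy 4-sphere (bare binders) has a minimal GK-trisection of genus `g₀`." For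
`g₀ = 3` this is the first open type (3;1,1,1) of `LowGenusTrisectionBarrier`. [folklore] -/
def NoMinimalGenus (g₀ : ℕ) : Prop :=
  ∀ (M : Type) [TopologicalSpace M] [T2Space M] [SecondCountableTopology M]
    [ChartedSpace (EuclideanSpace ℝ (Fin 4)) M] [IsManifold (𝓡 4) ∞ M],
    (M ≃ₕ 𝕊⁴) → ∀ (k : Fin 3 → ℕ) (T : Fin 3 → Set M),
      IsGKTrisection M g₀ k T → ¬ IsMinimalGenus M g₀

/-- A rung with no instances holds vacuously: `NoMinimalGenus 3 → DependentTripleAtThree`.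
[folklore] -/
theorem dependentTripleAtThree_of_noMinimalGenus (h : NoMinimalGenus 3) :
    DependentTripleAtThree := by
  rw [dependentTripleAtThree_iff]
  intro M _ _ _ _ _ e k T hT hmin
  exact absurd hmin (h M e k T hT)

/-! ### (a) The shield `S → C` -/

variable {M : Type} [TopologicalSpace M] [ChartedSpace (EuclideanSpace ℝ (Fin 4)) M]
  [IsManifold (𝓡 4) ∞ M]

/-- A diffeomorphism to the round sphere pulls GK's genus-`0` trisection of `S⁴` back to a
genus-`0` GK-trisection of `M` (as in the sibling workfiles of 17907 / 17834). [folklore] -/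
theorem exists_gkTrisection_genus_zero_of_diffeomorph (Φ : M ≃ₘ⟮𝓡 4, 𝓡 4⟯ 𝕊⁴) :
    ∃ T : Fin 3 → Set M, IsGKTrisection M 0 (fun _ => 0) T := by
  obtain ⟨S₀, hS₀⟩ := sphere_genusZero_gkTrisection_holds
  exact ⟨fun i => Φ.symm '' S₀ i, hS₀.isGKTrisection.image_diffeomorph' Φ.symm⟩

/-- If `M` is diffeomorphic to `S⁴`, no genus `g ≥ 1` is the minimal trisection genus of `M`.
[folklore] -/
theorem not_isMinimalGenus_of_diffeomorph (Φ : M ≃ₘ⟮𝓡 4, 𝓡 4⟯ 𝕊⁴) {g : ℕ} (hg : 1 ≤ g) :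
    ¬ IsMinimalGenus M g := by
  intro hmin
  obtain ⟨T₀, hT₀⟩ := exists_gkTrisection_genus_zero_of_diffeomorph Φ
  have := hmin 0 (fun _ => 0) T₀ hT₀
  omega

/-- Under the summit every rung `g₀ ≥ 1` is empty. [folklore] -/
theorem noMinimalGenus_of_spc4 (h : _root_.SmoothPoincare4) {g₀ : ℕ} (hg₀ : 1 ≤ g₀) :
    NoMinimalGenus g₀ := by
  intro M _ _ _ _ _ e k T _hT
  obtain ⟨Φ⟩ := h M ‹_› ‹_› e
  exact not_isMinimalGenus_of_diffeomorph Φ hg₀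

/-- **The crux is implied by the summit** (`S → C`, shield):
`SmoothPoincare4 → DependentTripleAtThree`, by vacuity of `genus 3 ∧ minimal`. [folklore] -/
theorem dependentTripleAtThree_of_spc4 (h : _root_.SmoothPoincare4) : DependentTripleAtThree :=
  dependentTripleAtThree_of_noMinimalGenus (noMinimalGenus_of_spc4 h (by norm_num))

/-! ### (b) Kill criterion -/

/-- A refutation of the crux refutes the summit. [folklore] -/
theorem not_spc4_of_not_dependentTripleAtThree (h : ¬ DependentTripleAtThree) :
    ¬ _root_.SmoothPoincare4 :=
  fun hs => h (dependentTripleAtThree_of_spc4 hs)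

/-- **What a kill would be**: a smooth homotopy 4-sphere `M` of trisection genus exactly `3`
(a genus-3 GK-trisection `T` that is minimal for `M`) whose minimal trisection `T` admits NO
dependent triple (`¬ DT M T`), and admitting no diffeomorphism to the round `S⁴`. [folklore] -/
theorem exotic_of_not_dependentTripleAtThree (h : ¬ DependentTripleAtThree) :
    ∃ (M : Type) (_ : TopologicalSpace M) (_ : T2Space M) (_ : SecondCountableTopology M)
      (_ : ChartedSpace (EuclideanSpace ℝ (Fin 4)) M) (_ : IsManifold (𝓡 4) ∞ M),
      Nonempty (M ≃ₕ 𝕊⁴) ∧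
      (∃ (k : Fin 3 → ℕ) (T : Fin 3 → Set M), IsGKTrisection M 3 k T ∧
        IsMinimalGenus M 3 ∧ ¬ DT M T) ∧
      IsEmpty (M ≃ₘ⟮𝓡 4, 𝓡 4⟯ 𝕊⁴) := by
  rw [dependentTripleAtThree_iff] at h
  push Not at h
  obtain ⟨M, _, _, _, _, _, e, k, T, hT, hmin, hdt⟩ := h
  exact ⟨M, ‹_›, ‹_›, ‹_›, ‹_›, ‹_›, ⟨e⟩, ⟨k, T, hT, hmin, hdt⟩,
    ⟨fun Φ => not_isMinimalGenus_of_diffeomorph (g := 3) Φ (by norm_num) hmin⟩⟩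

/-! ### (d) Modulo X_F the crux restates the (3;1,1,1) frontier -/

/-- The crux together with the route's support `DependentTripleGenusThreeStandard` (X_F = AZ25
Thm 1.4 / Cor 1.5 for homotopy spheres) empties the rung: a dependent triple in a genus-3
trisection makes `M ≅ S⁴`, whose genus-`0` trisection contradicts minimality. [folklore] -/
theorem noMinimalGenus_three_of (h1 : DependentTripleAtThree)
    (hF : DependentTripleGenusThreeStandard) : NoMinimalGenus 3 := by
  intro M _ _ _ _ _ e k T hT hmin
  have hdt : DT M T := (dependentTripleAtThree_iff.1 h1) M e k T hT hmin
  obtain ⟨Φ⟩ := hF M e k T hT hdt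
  exact not_isMinimalGenus_of_diffeomorph Φ (by norm_num) hmin

/-- **Crux ≡ frontier modulo X_F.** Modulo `DependentTripleGenusThreeStandard` the crux is
EQUIVALENT to "no smooth homotopy 4-sphere has minimal GK-trisection genus 3" — the (3;1,1,1)
case of SPC4-by-genus (`LowGenusTrisectionBarrier`'s first open type), exactly as the planner's
`why_might_fail` declares. [folklore] -/
theorem dependentTripleAtThree_iff_noMinimalGenus_three (hF : DependentTripleGenusThreeStandard) :
    DependentTripleAtThree ↔ NoMinimalGenus 3 :=
  ⟨fun h1 => noMinimalGenus_three_of h1 hF, dependentTripleAtThree_of_noMinimalGenus⟩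

/-- The sibling support X_F is itself SPC4-implied (trivially: SPC4 gives the diffeomorphism
for every homotopy sphere). [folklore] -/
theorem dependentTripleGenusThreeStandard_of_spc4 (h : _root_.SmoothPoincare4) :
    DependentTripleGenusThreeStandard := by
  intro M _ _ _ _ _ e k T _hT _hdt
  exact h M ‹_› ‹_› e

/-- K1 at genus 3 (weak reducibility of minimal genus-3 trisections) together with the support
`GenusThreeBase` (AZ25 Thm 1.3) empties the rung, hence gives the crux (the planner's
`dependentTripleAtThree_of_minimalWeaklyReducible` in `Cruxes/MinimalWeaklyReducible/Lines/
rung_split.lean` is the same statement; re-proved here for self-containedness).  (Informally K1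
at genus 3 gives the crux directly — `(c; c′) ↦ (c, c′, push-off of c′)` — but the push-off is
not formalised.) [folklore] -/
theorem dependentTripleAtThree_of_K1_of_genusThreeBase (h1 : MinimalWeaklyReducible)
    (h4 : GenusThreeBase) : DependentTripleAtThree := by
  refine dependentTripleAtThree_of_noMinimalGenus ?_
  intro M _ _ _ _ _ e k T hT hmin
  have hwr := h1 M e 3 k T hT le_rfl hmin
  obtain ⟨Φ⟩ := h4 M e k T hT hwr
  exact not_isMinimalGenus_of_diffeomorph Φ (by norm_num) hmin

/-! ### (f) The trisection hypothesis is load-bearing (conclusion is not decoration) -/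

/-- With empty sectors the dependent-triple clause fails: the central surface is empty while a
curve is the range of a map from the nonempty circle. [folklore] -/
theorem not_dt_empty (M : Type) [TopologicalSpace M] [ChartedSpace (EuclideanSpace ℝ (Fin 4)) M] :
    ¬ DT M (fun _ => (∅ : Set M)) := by
  rintro ⟨a, b, c, ⟨haF, γ, -, hγ⟩, -⟩
  have hF : (⋂ l : Fin 3, (fun _ : Fin 3 => (∅ : Set M)) l) = ∅ := by
    simpa using (iInter_const (ι := Fin 3) (s := (∅ : Set M)))
  have ha : a = ∅ := subset_empty_iff.mp (hF ▸ haF)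
  obtain ⟨x, hx⟩ := (NormedSpace.sphere_nonempty (x := (0 : EuclideanSpace ℝ (Fin 2)))
    (r := 1)).mpr zero_le_one
  have : γ ⟨x, hx⟩ ∈ a := hγ ▸ mem_range_self _
  simp [ha] at this

/-- **`_false_without_` the trisection hypothesis.** Dropping `IsGKTrisection M 3 k T` (and
minimality, which is about other trisections) from the crux — keeping the bare binders and
`e : M ≃ₕ S⁴` — gives a FALSE statement: witness the round `S⁴` itself with empty sectors.  Any
proof of X₁ must use the trisection hypothesis. [folklore] -/
theorem dt_false_without_trisection :
    ¬ ∀ (M : Type) [TopologicalSpace M] [T2Space M] [SecondCountableTopology M]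
        [ChartedSpace (EuclideanSpace ℝ (Fin 4)) M] [IsManifold (𝓡 4) ∞ M],
        (M ≃ₕ 𝕊⁴) → ∀ (_k : Fin 3 → ℕ) (T : Fin 3 → Set M), DT M T := by
  intro h
  exact not_dt_empty 𝕊⁴ (h 𝕊⁴ (ContinuousMap.HomotopyEquiv.refl 𝕊⁴) (fun _ => 1) (fun _ => ∅))

/-- **Minimality alone does not rescue it**: dropping only `IsGKTrisection M 3 k T` but KEEPING
`IsMinimalGenus M 3` is still no help formally unless one knows `S⁴` has small-genus trisections —
which the tree does (`sphere_genusZero_gkTrisection_holds`): so the minimality hypothesis is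
FALSE at `M = S⁴` and the dropped-trisection statement becomes vacuously TRUE there; the honest
mutation is the one above (both dropped). Recorded as the trivial implication. [folklore] -/
theorem not_isMinimalGenus_sphere {g : ℕ} (hg : 1 ≤ g) : ¬ IsMinimalGenus 𝕊⁴ g :=
  not_isMinimalGenus_of_diffeomorph (Diffeomorph.refl (𝓡 4) 𝕊⁴ ∞) hg

/-! ### (g) The type of a minimal genus-3 trisection of a homotopy sphere -/

section TypeOfMinimal

variable {N : Type} [TopologicalSpace N] [T2Space N] [SecondCountableTopology N]
  [ChartedSpace (EuclideanSpace ℝ (Fin 4)) N] [IsManifold (𝓡 4) ∞ N]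

/-- `M ≃ₕ S⁴` is compact (proved tree fact). [cite: HatcherAT2002, Prop. 3.29 and Cor. 2.11] -/
theorem compactSpace_of_he (e : N ≃ₕ 𝕊⁴) : CompactSpace N :=
  compactSpace_of_homotopyEquiv_sphere_four_holds N e

omit [T2Space N] [SecondCountableTopology N] [ChartedSpace (EuclideanSpace ℝ (Fin 4)) N]
  [IsManifold (𝓡 4) ∞ N] in
/-- `M ≃ₕ S⁴` is connected (path-connectedness of `S⁴` transported along `e`). [folklore] -/
theorem connectedSpace_of_he (e : N ≃ₕ 𝕊⁴) : ConnectedSpace N := by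
  haveI : PathConnectedSpace 𝕊⁴ := pathConnectedSpace_sphere_four
  haveI : PathConnectedSpace N := pathConnectedSpace_of_homotopyEquiv e
  infer_instance

/-- **Unconditionally `Σ kᵢ = 3`** for a genus-3 GK-trisection of a smooth homotopy 4-sphere
(bare binders): the proved Euler-characteristic fact. [cite: GayKirby2016, Remark 2] -/
theorem sum_k_eq_three (e : N ≃ₕ 𝕊⁴) {k : Fin 3 → ℕ} {T : Fin 3 → Set N}
    (hT : IsGKTrisection N 3 k T) : k 0 + k 1 + k 2 = 3 := by
  haveI := compactSpace_of_he e
  haveI := connectedSpace_of_he e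
  obtain ⟨o⟩ := isOrientable_of_homotopyEquiv_sphere_four_holds N e
  exact (gkTrisection_genus_eq_sum_of_homotopyEquiv_sphere_holds N o 3 k T hT e).symm

/-- **Modulo MSZ16 the type is `(3;1,1,1)`.** Under the crux's hypotheses (genus-3 trisection
that is MINIMAL for `M ≃ₕ S⁴`), GIVEN the tree's named fact `msz_homotopySphere_gk` (MSZ16
Thm 1.2 for homotopy spheres, UNPROVED in tree), every `k i = 1`: minimality makes `M` admit no
diffeomorphism to `S⁴` (else genus `0`), and `eq_one_of_exotic_of_genus_three_of_msz_alone`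
applies. [cite: MeierSchirmerZupan2016, Thm. 1.2 and Remark 3.12] -/
theorem k_eq_one_of_minimal_of_msz
    (hMSZ : Literature.Barriers.SmoothPoincare4.msz_homotopySphere_gk.{0})
    (e : N ≃ₕ 𝕊⁴) {k : Fin 3 → ℕ} {T : Fin 3 → Set N}
    (hT : IsGKTrisection N 3 k T) (hmin : IsMinimalGenus N 3) (i : Fin 3) : k i = 1 := by
  haveI := compactSpace_of_he e
  haveI := connectedSpace_of_he e
  obtain ⟨o⟩ := isOrientable_of_homotopyEquiv_sphere_four_holds N e
  have hE : IsEmpty (N ≃ₘ⟮𝓡 4, 𝓡 4⟯ 𝕊⁴) :=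
    ⟨fun Φ => not_isMinimalGenus_of_diffeomorph Φ (by norm_num) hmin⟩
  exact Literature.Barriers.SmoothPoincare4.eq_one_of_exotic_of_genus_three_of_msz_alone
    hMSZ N o hT e hE i

end TypeOfMinimal

/-- The crux restricted to the balanced type `(3;1,1,1)` (`k = fun _ => 1`), everything else
verbatim. [folklore] -/
def DependentTripleAtThree111 : Prop :=
  ∀ (M : Type) [TopologicalSpace M] [T2Space M] [SecondCountableTopology M]
    [ChartedSpace (EuclideanSpace ℝ (Fin 4)) M] [IsManifold (𝓡 4) ∞ M],
    (M ≃ₕ 𝕊⁴) → ∀ (T : Fin 3 → Set M),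
      IsGKTrisection M 3 (fun _ => 1) T → IsMinimalGenus M 3 → DT M T

/-- **Modulo MSZ16 the crux is its `(3;1,1,1)` case**: `DependentTripleAtThree ↔
DependentTripleAtThree111` given `msz_homotopySphere_gk` (the other types carry no minimal
trisection of a homotopy sphere).  The hidden input MSZ16 is not among the route's items.
[cite: MeierSchirmerZupan2016, Thm. 1.2 and Remark 3.12] -/
theorem dependentTripleAtThree_iff_balanced_of_msz
    (hMSZ : Literature.Barriers.SmoothPoincare4.msz_homotopySphere_gk.{0}) :
    DependentTripleAtThree ↔ DependentTripleAtThree111 := by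
  rw [dependentTripleAtThree_iff]
  constructor
  · intro h M _ _ _ _ _ e T hT hmin
    exact h M e (fun _ => 1) T hT hmin
  · intro h M _ _ _ _ _ e k T hT hmin
    have hk : k = fun _ => 1 := funext fun i => k_eq_one_of_minimal_of_msz hMSZ e hT hmin i
    subst hk
    exact h M e T hT hmin

end Summit.SmoothPoincare4.SmoothPoincare4.Cruxes.DependentTripleAtThree.BirthAttack
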